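import Summits.Ventures.PercRepro.Night2NearFatPlanar

/-!
# night-2: THE DISTANCE-2 LOADS ARE LOW (gen 40)

A distance-2 load `Q_b ∪ {x, x′}` needs a lossy big set `Q_b` with NO good point, so `V` is covered by the three planes through
the line `cl R` of `Q_b` and the three coloops `c, d, e` (`cover_of_gtPts_eq_empty`, Night2NearFatPlanar's argument with the rank-2
set `R` explicit).  The three faces `cl (Q_b.erase c)` each miss `≥ 3` points of `G` (no fat closure) and these missed sets are
pairwise disjoint and disjoint from `cl R` (each lies on its own plane), so **`|V ∩ cl R| + 9 ≤ |V|`**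
(`card_inter_clF_add_nine_le_of_gtPts_eq_empty`).  For a target `Q ∪ Y` of a basis pair this `R` has `|R| = |Y|` and `≥ |Y| − 2`
points of `Y` on `cl R`, hence `|Y| ≤ |V| − 9 = |W| − 4`: **a distance-2 load has level `≤ |W| − 4`** — at the top four levels
every load is a distance-1 load (`exists_good_of_dload_ne_zero_of_top`) and the shape lemma holds with no three-planar hypothesis
(`dload_eq_zero_of_shape_of_top`).  Paper: proofs/NIGHT-2-g40.md §8.
-/

namespace PercRepro.Shadow

open PercRepro.ThmH PercRepro.PerFlat

variable {α : Type*} [DecidableEq α] {M : Matroid α} [M.Finite] {G : Finset α}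

/-- **The three-plane cover with the rank-2 set explicit**: with no good point, `V ⊆ cl (R ∪ c) ∪ cl (R ∪ d) ∪ cl (R ∪ e)` for the
three coloops `c, d, e` of `Q_b ∖ K`. -/
theorem cover_of_gtPts_eq_empty (hG : G ∈ flatsQ M (5 + 1)) (hd : (gr M \ G).card = 2)
    (hk : kColoops M G = 1) (hs : ∀ e ∈ gr M, ∀ f ∈ gr M, e ≠ f → rkN M {e, f} = 2)
    (hl : ∀ e ∈ gr M, M.Indep {e}) {B : Finset α} (hB : B ∈ thinMembers M 5 G)
    (hbig : 5 ≤ (B \ coloops M G).card) {z : α} (hz : z ∈ G \ clF M B) (hloss : loss M 5 G B z ≠ 0)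
    {R : Finset α} (hRQ : R ⊆ insert z B \ coloops M G) (hR2 : rkN M R = 2)
    (hRcard : R.card + 3 = (insert z B \ coloops M G).card) (hempty : gtPts M 5 G (insert z B) = ∅) :
    ∃ c ∈ coloops M (insert z B \ coloops M G), ∃ d ∈ coloops M (insert z B \ coloops M G),
      ∃ e ∈ coloops M (insert z B \ coloops M G), c ≠ d ∧ c ≠ e ∧ d ≠ e ∧
      G \ coloops M G ⊆ clF M (insert c R) ∪ clF M (insert d R) ∪ clF M (insert e R) := by
  have hcol := coloops_eq_sdiff_of_loss_ne_zero hG hd hk hs hl hB hbig hz hloss hRQ hR2 hRcard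
  have h3 := card_coloops_eq_three_of_loss_ne_zero hG hd hk hs hl hB hbig hz hloss
  obtain ⟨c, d, e, hcd, hce, hde, hC⟩ := Finset.card_eq_three.1 h3
  have hfaces := thinFacesOf_eq_image_erase hG hd hk hs hl hB hbig hz hloss
  have hGg : G ⊆ gr M := (mem_flatsQ.1 hG).1
  have hQG : insert z B ⊆ G :=
    Finset.insert_subset (Finset.mem_sdiff.1 hz).1 (subset_G_of_mem_thinMembers hB)
  have hKB : coloops M G ⊆ B := coloops_subset_of_mem_thinMembers hG (by omega) hB
  have hQ'V : insert z B \ coloops M G ⊆ G \ coloops M G := fun w hw =>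
    Finset.mem_sdiff.2 ⟨hQG (Finset.mem_sdiff.1 hw).1, (Finset.mem_sdiff.1 hw).2⟩
  have hVg : G \ coloops M G ⊆ gr M := Finset.sdiff_subset.trans hGg
  have hmemC : ∀ w, w ∈ coloops M (insert z B \ coloops M G) ↔ w = c ∨ w = d ∨ w = e := by
    intro w
    rw [hC, Finset.mem_insert, Finset.mem_insert, Finset.mem_singleton]
  have hcQ : c ∈ insert z B \ coloops M G := (mem_coloops.1 ((hmemC c).2 (Or.inl rfl))).1
  have hdQ : d ∈ insert z B \ coloops M G := (mem_coloops.1 ((hmemC d).2 (Or.inr (Or.inl rfl)))).1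
  have heQ : e ∈ insert z B \ coloops M G := (mem_coloops.1 ((hmemC e).2 (Or.inr (Or.inr rfl)))).1
  have hmem : ∀ w ∈ insert z B \ coloops M G, w ∈ R ∨ w = c ∨ w = d ∨ w = e := by
    intro w hw
    by_cases hwR : w ∈ R
    · exact Or.inl hwR
    · right
      rw [← hmemC, hcol, Finset.mem_sdiff]
      exact ⟨hw, hwR⟩
  obtain ⟨h1, h2, h3', h4, h5, h6⟩ := sdiff_pair_subset_insert hmem
  have hins : ∀ u : α, u ∈ G \ coloops M G → insert u R ⊆ gr M := fun u hu =>
    Finset.insert_subset (hVg hu) (hRQ.trans (hQ'V.trans hVg))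
  refine ⟨c, (hmemC c).2 (Or.inl rfl), d, (hmemC d).2 (Or.inr (Or.inl rfl)), e, (hmemC e).2 (Or.inr (Or.inr rfl)),
    hcd, hce, hde, ?_⟩
  intro x hx
  rw [Finset.mem_union, Finset.mem_union]
  by_cases hxQ : x ∈ insert z B
  · have hxQ' : x ∈ insert z B \ coloops M G := Finset.mem_sdiff.2 ⟨hxQ, (Finset.mem_sdiff.1 hx).2⟩
    rcases hmem x hxQ' with h | rfl | rfl | rfl
    · exact Or.inl (Or.inl (subset_clF_of_subset_gr (hins c (hQ'V hcQ)) (Finset.mem_insert_of_mem h)))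
    · exact Or.inl (Or.inl (subset_clF_of_subset_gr (hins x hx) (Finset.mem_insert_self _ _)))
    · exact Or.inl (Or.inr (subset_clF_of_subset_gr (hins x hx) (Finset.mem_insert_self _ _)))
    · exact Or.inr (subset_clF_of_subset_gr (hins x hx) (Finset.mem_insert_self _ _))
  · -- `x` is in no good position: two faces contain it
    have hxg : x ∉ gtPts M 5 G (insert z B) := by
      rw [hempty]
      exact Finset.notMem_empty x
    rw [mem_goodPts, not_and] at hxg
    have h2le : 2 ≤ ((thinFacesOf M 5 G (insert z B)).filter (fun F => x ∈ clF M F)).card := by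
      have := hxg (Finset.mem_sdiff.2 ⟨(Finset.mem_sdiff.1 hx).1, hxQ⟩)
      omega
    obtain ⟨F₁, hF₁, F₂, hF₂, hF12⟩ := Finset.one_lt_card.1 h2le
    rw [Finset.mem_filter, hfaces, Finset.mem_image] at hF₁ hF₂
    obtain ⟨⟨c₁, hc₁, rfl⟩, hx₁⟩ := hF₁
    obtain ⟨⟨c₂, hc₂, rfl⟩, hx₂⟩ := hF₂
    have hc12 : c₁ ≠ c₂ := fun h => hF12 (by rw [h])
    have hplane := mem_clF_sdiff_of_mem_two_faces hG hd hk hB hz hc₁ hc₂ hc12 hx hx₁ hx₂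
    rcases (hmemC c₁).1 hc₁ with rfl | rfl | rfl <;> rcases (hmemC c₂).1 hc₂ with rfl | rfl | rfl
    · exact absurd rfl hc12
    · exact Or.inr (clF_mono h1 hplane)
    · exact Or.inl (Or.inr (clF_mono h3' hplane))
    · exact Or.inr (clF_mono h2 hplane)
    · exact absurd rfl hc12
    · exact Or.inl (Or.inl (clF_mono h5 hplane))
    · exact Or.inl (Or.inr (clF_mono h4 hplane))
    · exact Or.inl (Or.inl (clF_mono h6 hplane))
    · exact absurd rfl hc12


/-- **The line of a lossy big set with no good point is short**: `|V ∩ cl R| + 9 ≤ |V|` — the three faces each miss `≥ 3`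
points, pairwise disjoint and off `cl R`. -/
theorem card_inter_clF_add_nine_le_of_gtPts_eq_empty (hG : G ∈ flatsQ M (5 + 1)) (hd : (gr M \ G).card = 2)
    (hk : kColoops M G = 1) (hs : ∀ e ∈ gr M, ∀ f ∈ gr M, e ≠ f → rkN M {e, f} = 2)
    (hl : ∀ e ∈ gr M, M.Indep {e}) (hnf : fatClosures M 5 G 2 = ∅) {B : Finset α} (hB : B ∈ thinMembers M 5 G)
    (hbig : 5 ≤ (B \ coloops M G).card) {z : α} (hz : z ∈ G \ clF M B) (hloss : loss M 5 G B z ≠ 0)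
    {R : Finset α} (hRQ : R ⊆ insert z B \ coloops M G) (hR2 : rkN M R = 2)
    (hRcard : R.card + 3 = (insert z B \ coloops M G).card) (hempty : gtPts M 5 G (insert z B) = ∅) :
    ((G \ coloops M G) ∩ clF M R).card + 9 ≤ (G \ coloops M G).card := by
  obtain ⟨c, hc, d, hd', e, he, hcd, hce, hde, hcov⟩ :=
    cover_of_gtPts_eq_empty hG hd hk hs hl hB hbig hz hloss hRQ hR2 hRcard hempty
  have hcol := coloops_eq_sdiff_of_loss_ne_zero hG hd hk hs hl hB hbig hz hloss hRQ hR2 hRcard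
  have hfaces := thinFacesOf_eq_image_erase hG hd hk hs hl hB hbig hz hloss
  have hGg : G ⊆ gr M := (mem_flatsQ.1 hG).1
  have hQG : insert z B ⊆ G :=
    Finset.insert_subset (Finset.mem_sdiff.1 hz).1 (subset_G_of_mem_thinMembers hB)
  have hKB : coloops M G ⊆ B := coloops_subset_of_mem_thinMembers hG (by omega) hB
  have hRg : R ⊆ gr M := hRQ.trans (Finset.sdiff_subset.trans (hQG.trans hGg))
  -- each face is a thin member
  have hthin : ∀ u ∈ coloops M (insert z B \ coloops M G), (insert z B).erase u ∈ thinMembers M 5 G := by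
    intro u hu
    have hF : (insert z B).erase u ∈ thinFacesOf M 5 G (insert z B) := by
      rw [hfaces, Finset.mem_image]
      exact ⟨u, hu, rfl⟩
    unfold thinFacesOf at hF
    rw [Finset.mem_filter, mem_coverPreimages] at hF
    exact mem_thinMembers.2 ⟨hF.1.1, hF.2⟩
  -- the missed sets
  have hmiss : ∀ u ∈ coloops M (insert z B \ coloops M G), 3 ≤ (G \ clF M ((insert z B).erase u)).card :=
    fun u hu => three_le_card_sdiff_of_nonfat hnf (hthin u hu)
  have hmissV : ∀ u ∈ coloops M (insert z B \ coloops M G), G \ clF M ((insert z B).erase u) ⊆ G \ coloops M G := by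
    intro u hu x hx
    rw [Finset.mem_sdiff] at hx ⊢
    refine ⟨hx.1, fun hxK => hx.2 ?_⟩
    have hxB : x ∈ B := hKB hxK
    have huK : u ∉ coloops M G := (Finset.mem_sdiff.1 (mem_coloops.1 hu).1).2
    have hxu : x ≠ u := fun h => huK (h ▸ hxK)
    exact subset_clF_of_subset_gr ((Finset.erase_subset _ _).trans (hQG.trans hGg))
      (Finset.mem_erase.2 ⟨hxu, Finset.mem_insert_of_mem hxB⟩)
  -- `R` and the other two coloops lie inside the face at `u`
  have hsubface : ∀ u ∈ coloops M (insert z B \ coloops M G), ∀ v ∈ coloops M (insert z B \ coloops M G), u ≠ v →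
      insert v R ⊆ (insert z B).erase u := by
    intro u hu v hv huv x hx
    rw [Finset.mem_insert] at hx
    rw [Finset.mem_erase]
    rcases hx with rfl | hxR
    · exact ⟨Ne.symm huv, (Finset.mem_sdiff.1 (mem_coloops.1 hv).1).1⟩
    · refine ⟨fun h => ?_, (Finset.mem_sdiff.1 (hRQ hxR)).1⟩
      subst h
      have : x ∈ (insert z B \ coloops M G) \ R := hcol ▸ hu
      exact (Finset.mem_sdiff.1 this).2 hxR
  -- disjointness of the missed sets
  have hdisj : ∀ u ∈ coloops M (insert z B \ coloops M G), ∀ v ∈ coloops M (insert z B \ coloops M G), u ≠ v →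
      ∀ x, x ∈ G \ clF M ((insert z B).erase u) → x ∈ G \ clF M ((insert z B).erase v) → False := by
    intro u hu v hv huv x hxu hxv
    have hxV : x ∈ G \ coloops M G := hmissV u hu hxu
    have hxcov := hcov hxV
    rw [Finset.mem_union, Finset.mem_union] at hxcov
    -- each plane lies in a face at a coloop other than its own
    have key : ∀ w ∈ coloops M (insert z B \ coloops M G), x ∈ clF M (insert w R) → False := by
      intro w hw hxw
      by_cases hwu : w = u
      · subst hwu
        exact (Finset.mem_sdiff.1 hxv).2 (clF_mono (hsubface v hv w hw (Ne.symm huv)) hxw)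
      · exact (Finset.mem_sdiff.1 hxu).2 (clF_mono (hsubface u hu w hw (Ne.symm hwu)) hxw)
    rcases hxcov with (h | h) | h
    · exact key c hc h
    · exact key d hd' h
    · exact key e he h
  -- the line is inside every face
  have hline : ∀ u ∈ coloops M (insert z B \ coloops M G), ∀ x, x ∈ clF M R → x ∉ G \ clF M ((insert z B).erase u) := by
    intro u hu x hx hxu
    have hsub : R ⊆ (insert z B).erase u := by
      intro r hr
      rw [Finset.mem_erase]
      refine ⟨fun h => ?_, (Finset.mem_sdiff.1 (hRQ hr)).1⟩
      subst h
      have : r ∈ (insert z B \ coloops M G) \ R := hcol ▸ hu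
      exact (Finset.mem_sdiff.1 this).2 hr
    exact (Finset.mem_sdiff.1 hxu).2 (clF_mono hsub hx)
  -- assemble: `(V ∩ cl R) ∪ S_c ∪ S_d ∪ S_e ⊆ V`, pairwise disjoint
  set A := (G \ coloops M G) ∩ clF M R with hA
  set Sc := G \ clF M ((insert z B).erase c) with hSc
  set Sd := G \ clF M ((insert z B).erase d) with hSd
  set Se := G \ clF M ((insert z B).erase e) with hSe
  have h1 : (A ∪ Sc).card = A.card + Sc.card := by
    have := Finset.card_union_add_card_inter A Sc
    have h0 : (A ∩ Sc).card = 0 := by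
      rw [Finset.card_eq_zero, Finset.eq_empty_iff_forall_notMem]
      intro x hx
      rw [Finset.mem_inter] at hx
      exact hline c hc x (Finset.mem_inter.1 hx.1).2 hx.2
    omega
  have h2 : (A ∪ Sc ∪ Sd).card = A.card + Sc.card + Sd.card := by
    have := Finset.card_union_add_card_inter (A ∪ Sc) Sd
    have h0 : ((A ∪ Sc) ∩ Sd).card = 0 := by
      rw [Finset.card_eq_zero, Finset.eq_empty_iff_forall_notMem]
      intro x hx
      rw [Finset.mem_inter, Finset.mem_union] at hx
      rcases hx.1 with h | h
      · exact hline d hd' x (Finset.mem_inter.1 h).2 hx.2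
      · exact hdisj c hc d hd' hcd x h hx.2
    omega
  have h3 : (A ∪ Sc ∪ Sd ∪ Se).card = A.card + Sc.card + Sd.card + Se.card := by
    have := Finset.card_union_add_card_inter (A ∪ Sc ∪ Sd) Se
    have h0 : ((A ∪ Sc ∪ Sd) ∩ Se).card = 0 := by
      rw [Finset.card_eq_zero, Finset.eq_empty_iff_forall_notMem]
      intro x hx
      rw [Finset.mem_inter, Finset.mem_union, Finset.mem_union] at hx
      rcases hx.1 with (h | h) | h
      · exact hline e he x (Finset.mem_inter.1 h).2 hx.2
      · exact hdisj c hc e he hce x h hx.2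
      · exact hdisj d hd' e he hde x h hx.2
    omega
  have hsubV : A ∪ Sc ∪ Sd ∪ Se ⊆ G \ coloops M G :=
    Finset.union_subset (Finset.union_subset (Finset.union_subset Finset.inter_subset_left (hmissV c hc))
      (hmissV d hd')) (hmissV e he)
  have hV := Finset.card_le_card hsubV
  have hc3 : 3 ≤ Sc.card := hmiss c hc
  have hd3 : 3 ≤ Sd.card := hmiss d hd'
  have he3 : 3 ≤ Se.card := hmiss e he
  omega

/-- **At the top four levels every load is a distance-1 load**: a distance-2 load of `Q ∪ Y` has a rank-2 set `R ⊆ V ∩ cl R`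
with `|R| = |Y|` and `|V ∩ cl R| ≤ |V| − 9 = |W| − 4`, against `|W| ≤ |Y| + 3`. -/
theorem exists_good_of_dload_ne_zero_of_top (hG : G ∈ flatsQ M (5 + 1)) (hd : (gr M \ G).card = 2)
    (hk : kColoops M G = 1) (hs : ∀ e ∈ gr M, ∀ f ∈ gr M, e ≠ f → rkN M {e, f} = 2)
    (hl : ∀ e ∈ gr M, M.Indep {e}) (hnf : fatClosures M 5 G 2 = ∅) {B : Finset α} (hB : B ∈ thinMembers M 5 G)
    (hnP : ¬ bigP M G B) {z : α} (hz : z ∈ G \ clF M B) {Y : Finset α} (hY : Y ⊆ G \ insert z B)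
    (htop : (G \ insert z B).card ≤ Y.card + 3)
    (hne : dload M 5 G (bigP M G) (dshGT2 M 5 G) (insert z B ∪ Y) ≠ 0) :
    ∃ B' ∈ thinMembers M 5 G, 5 ≤ (B' \ coloops M G).card ∧ ∃ z' ∈ G \ clF M B', loss M 5 G B' z' ≠ 0 ∧
      ∃ x ∈ gtPts M 5 G (insert z' B'), insert z B ∪ Y = insert x (insert z' B') := by
  have hfat : (fatClosures M 5 G 2).card ≤ 1 := by
    rw [hnf, Finset.card_empty]
    exact zero_le_one
  obtain ⟨B', hB', hbig, z', hz', hloss, hcase⟩ := exists_pair_of_dload_ne_zero' hG hd hk hs hl hfat hne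
  rcases hcase with ⟨-, x, hx, heq⟩ | ⟨hno, p, hp, heq⟩
  · exact ⟨B', hB', hbig, z', hz', hloss, x, hx, heq⟩
  · exfalso
    have hempty : gtPts M 5 G (insert z' B') = ∅ := Finset.not_nonempty_iff_eq_empty.1 hno
    obtain ⟨R, hRQ, hR2, hRcard⟩ := exists_rank_two_of_loss_ne_zero hG hd hk hs hl hB' hbig hz' hloss
    have h9 := card_inter_clF_add_nine_le_of_gtPts_eq_empty hG hd hk hs hl hnf hB' hbig hz' hloss hRQ hR2 hRcard hempty
    have hGg : G ⊆ gr M := (mem_flatsQ.1 hG).1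
    have hQ'G : insert z' B' ⊆ G :=
      Finset.insert_subset (Finset.mem_sdiff.1 hz').1 (subset_G_of_mem_thinMembers hB')
    have hKB' : coloops M G ⊆ B' := coloops_subset_of_mem_thinMembers hG (by omega) hB'
    -- `|T′| = |Q_b′| + 2`
    rw [mem_d2Pts] at hp
    obtain ⟨⟨hp1, hp2⟩, hp12, -⟩ := hp
    have hp1K : p.1 ∉ coloops M G := fun h => (Finset.mem_sdiff.1 hp1).2 (Finset.mem_insert_of_mem (hKB' h))
    have hp2K : p.2 ∉ coloops M G := fun h => (Finset.mem_sdiff.1 hp2).2 (Finset.mem_insert_of_mem (hKB' h))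
    have hT' : (insert z B ∪ Y) \ coloops M G = insert p.1 (insert p.2 (insert z' B' \ coloops M G)) := by
      rw [heq, insert_sdiff_coloops_eq hp1K, insert_sdiff_coloops_eq hp2K]
    have hcardT := card_union_sdiff_coloops_eq hG hd hk hB hnP hz hY
    rw [hT', Finset.card_insert_of_notMem, Finset.card_insert_of_notMem
      (fun h => (Finset.mem_sdiff.1 hp2).2 (Finset.mem_sdiff.1 h).1)] at hcardT
    · -- `|R| = |Y|` and `R ⊆ V ∩ cl R`
      have hRsub : R ⊆ (G \ coloops M G) ∩ clF M R := by
        intro r hr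
        rw [Finset.mem_inter]
        exact ⟨Finset.mem_sdiff.2 ⟨hQ'G (Finset.mem_sdiff.1 (hRQ hr)).1, (Finset.mem_sdiff.1 (hRQ hr)).2⟩,
          subset_clF_of_subset_gr (hRQ.trans (Finset.sdiff_subset.trans (hQ'G.trans hGg))) hr⟩
      have hRle := Finset.card_le_card hRsub
      -- `|V| = |W| + 5`
      have hW := card_sdiff_insert_eq_card_sub_six hG hd hk hB hnP hz
      have hk1 : (coloops M G).card = 1 := by
        rw [← kColoops_eq_card_coloops]
        exact hk
      have hKG : coloops M G ⊆ G := by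
        unfold coloops
        exact Finset.filter_subset _ _
      have hV : (G \ coloops M G).card = G.card - 1 := by
        rw [Finset.card_sdiff_of_subset hKG, hk1]
      have hQ6 : 6 ≤ G.card := by
        have hQG : insert z B ⊆ G := Finset.insert_subset (Finset.mem_sdiff.1 hz).1 (subset_G_of_mem_thinMembers hB)
        have h5 := (rkN_insert_sdiff_coloops_eq_five hG hd hk hB hnP hz).2
        have hKQ : coloops M G ⊆ insert z B :=
          fun x hx => Finset.mem_insert_of_mem (coloops_subset_of_mem_thinMembers hG (by omega) hB hx)
        have := Finset.card_sdiff_of_subset hKQ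
        have := Finset.card_le_card hQG
        omega
      omega
    · rw [Finset.mem_insert, Finset.mem_sdiff, not_or]
      exact ⟨hp12, fun h => (Finset.mem_sdiff.1 hp1).2 h.1⟩

/-- The rank-2 set of a load at the top four levels has `|T ∖ K| = |R| + 4`. -/
theorem exists_rank_two_card_of_dload_ne_zero_of_top (hG : G ∈ flatsQ M (5 + 1)) (hd : (gr M \ G).card = 2)
    (hk : kColoops M G = 1) (hs : ∀ e ∈ gr M, ∀ f ∈ gr M, e ≠ f → rkN M {e, f} = 2)
    (hl : ∀ e ∈ gr M, M.Indep {e}) (hnf : fatClosures M 5 G 2 = ∅) {B : Finset α} (hB : B ∈ thinMembers M 5 G)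
    (hnP : ¬ bigP M G B) {z : α} (hz : z ∈ G \ clF M B) {Y : Finset α} (hY : Y ⊆ G \ insert z B)
    (htop : (G \ insert z B).card ≤ Y.card + 3)
    (hne : dload M 5 G (bigP M G) (dshGT2 M 5 G) (insert z B ∪ Y) ≠ 0) :
    ∃ R ⊆ (insert z B ∪ Y) \ coloops M G, rkN M R = 2 ∧ ((insert z B ∪ Y) \ coloops M G).card = R.card + 4 := by
  obtain ⟨B', hB', hbig, z', hz', hloss, x, hx, heq⟩ :=
    exists_good_of_dload_ne_zero_of_top hG hd hk hs hl hnf hB hnP hz hY htop hne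
  obtain ⟨R, hRQ, hR2, hRcard⟩ := exists_rank_two_of_loss_ne_zero hG hd hk hs hl hB' hbig hz' hloss
  have hxQ : x ∈ G \ insert z' B' := (mem_goodPts.1 hx).1
  have hKB' : coloops M G ⊆ B' := coloops_subset_of_mem_thinMembers hG (by omega) hB'
  have hxK : x ∉ coloops M G := fun h => (Finset.mem_sdiff.1 hxQ).2 (Finset.mem_insert_of_mem (hKB' h))
  have heq' : (insert z B ∪ Y) \ coloops M G = insert x (insert z' B' \ coloops M G) := by
    rw [heq, insert_sdiff_coloops_eq hxK]
  refine ⟨R, hRQ.trans (by rw [heq']; exact Finset.subset_insert _ _), hR2, ?_⟩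
  rw [heq', Finset.card_insert_of_notMem (fun h => (Finset.mem_sdiff.1 hxQ).2 (Finset.mem_sdiff.1 h).1)]
  omega

/-- **THE SHAPE LEMMA AT THE TOP FOUR LEVELS** (no three-planar hypothesis): a target `Q ∪ Y` with `|W| ≤ |Y| + 3` whose `Y` has
at most `|Y| − 2` points on every basis line and lies inside no line through a basis point is unloaded. -/
theorem dload_eq_zero_of_shape_of_top (hG : G ∈ flatsQ M (5 + 1)) (hd : (gr M \ G).card = 2)
    (hk : kColoops M G = 1) (hs : ∀ e ∈ gr M, ∀ f ∈ gr M, e ≠ f → rkN M {e, f} = 2)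
    (hl : ∀ e ∈ gr M, M.Indep {e}) (hnf : fatClosures M 5 G 2 = ∅)
    {B : Finset α} (hB : B ∈ thinMembers M 5 G) (hnP : ¬ bigP M G B) {z : α} (hz : z ∈ G \ clF M B)
    {Y : Finset α} (hY : Y ⊆ G \ insert z B) (htop : (G \ insert z B).card ≤ Y.card + 3)
    (h2 : ∀ a ∈ insert z B \ coloops M G, ∀ b ∈ insert z B \ coloops M G, a ≠ b →
      (Y ∩ clF M {a, b}).card + 2 ≤ Y.card)
    (h1 : ∀ a ∈ insert z B \ coloops M G, ∀ y ∈ Y, ¬ Y ⊆ clF M {a, y}) :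
    dload M 5 G (bigP M G) (dshGT2 M 5 G) (insert z B ∪ Y) = 0 := by
  by_contra hne
  obtain ⟨R, hRT, hR2, hcard⟩ :=
    exists_rank_two_card_of_dload_ne_zero_of_top hG hd hk hs hl hnf hB hnP hz hY htop hne
  have hGg : G ⊆ gr M := (mem_flatsQ.1 hG).1
  have hBG : B ⊆ G := subset_G_of_mem_thinMembers hB
  have hQG : insert z B ⊆ G := Finset.insert_subset (Finset.mem_sdiff.1 hz).1 hBG
  have hT'K := union_sdiff_coloops_eq_of_subset hG hd hB (z := z) hY
  have hcardT := card_union_sdiff_coloops_eq hG hd hk hB hnP hz hY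
  have hind : M.Indep ((insert z B \ coloops M G : Finset α) : Set α) :=
    (indep_insert_of_basis_pair hG hd hk hB hnP hz).subset (by exact_mod_cast (Finset.sdiff_subset))
  have hRQ' : (R ∩ (insert z B \ coloops M G)).card ≤ 2 := by
    rw [Finset.inter_comm]
    exact card_inter_le_two_of_indep_of_rkN_le_two hind hR2.le
  have hRg : R ⊆ gr M :=
    hRT.trans (Finset.sdiff_subset.trans ((Finset.union_subset hQG (hY.trans Finset.sdiff_subset)).trans hGg))
  have hRsub : R ⊆ (R ∩ (insert z B \ coloops M G)) ∪ (R ∩ Y) := by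
    intro r hr
    have hrT := hRT hr
    rw [hT'K, Finset.mem_union] at hrT
    rcases hrT with h | h
    · exact Finset.mem_union_left _ (Finset.mem_inter.2 ⟨hr, h⟩)
    · exact Finset.mem_union_right _ (Finset.mem_inter.2 ⟨hr, h⟩)
  have hRY : R.card ≤ (R ∩ (insert z B \ coloops M G)).card + (R ∩ Y).card := by
    have h1' := Finset.card_le_card hRsub
    have h2' := Finset.card_union_le (R ∩ (insert z B \ coloops M G)) (R ∩ Y)
    omega
  have hRcard : R.card = Y.card + 1 := by omega
  have hpairg : ∀ u v : α, u ∈ G → v ∈ G → ({u, v} : Finset α) ⊆ gr M := by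
    intro u v hu hv e he
    rw [Finset.mem_insert, Finset.mem_singleton] at he
    rcases he with rfl | rfl
    · exact hGg hu
    · exact hGg hv
  have hline : ∀ u v : α, u ∈ G → v ∈ G → u ≠ v → u ∈ R → v ∈ R → R ⊆ clF M {u, v} := by
    intro u v hu hv huv huR hvR
    exact subset_clF_of_rkN_le_two_of_two_mem hs hRg hR2.le huR hvR huv
      (subset_clF_of_subset_gr (hpairg u v hu hv) (Finset.mem_insert_self _ _))
      (subset_clF_of_subset_gr (hpairg u v hu hv) (Finset.mem_insert_of_mem (Finset.mem_singleton_self _)))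
  have hWmem : ∀ y ∈ Y, y ∈ G := fun y hy => (Finset.mem_sdiff.1 (hY hy)).1
  have hQmem : ∀ a ∈ insert z B \ coloops M G, a ∈ G := fun a ha => hQG (Finset.mem_sdiff.1 ha).1
  rcases Nat.lt_or_ge (R ∩ (insert z B \ coloops M G)).card 1 with hr0 | hr1
  · -- no basis point: `|R ∩ Y| ≥ |Y| + 1`, impossible
    have := Finset.card_le_card (Finset.inter_subset_right (s₁ := R) (s₂ := Y))
    omega
  · rcases Nat.lt_or_ge (R ∩ (insert z B \ coloops M G)).card 2 with hr1' | hr2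
    · -- one basis point `a`: `Y ⊆ R ⊆ cl {a, y}`
      obtain ⟨a, ha⟩ := Finset.card_pos.1 (show 0 < (R ∩ (insert z B \ coloops M G)).card by omega)
      have hRY' : Y.card ≤ (R ∩ Y).card := by omega
      have hYR : Y ⊆ R := by
        have hsub : R ∩ Y ⊆ Y := Finset.inter_subset_right
        have heq : R ∩ Y = Y := Finset.eq_of_subset_of_card_le hsub hRY'
        intro y hy
        rw [← heq] at hy
        exact (Finset.mem_inter.1 hy).1
      have hYne : Y.Nonempty := by
        rw [← Finset.card_pos]
        have := rkN_le_card (M := M) R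
        omega
      obtain ⟨y, hy⟩ := hYne
      have hay : a ≠ y := by
        intro h
        subst h
        exact (Finset.mem_sdiff.1 (hY hy)).2 (Finset.mem_sdiff.1 (Finset.mem_inter.1 ha).2).1
      have hsub := hline a y (hQmem a (Finset.mem_inter.1 ha).2) (hWmem y hy) hay
        (Finset.mem_inter.1 ha).1 (hYR hy)
      exact h1 a (Finset.mem_inter.1 ha).2 y hy (hYR.trans hsub)
    · -- two basis points `a ≠ b`: `|Y ∩ cl {a, b}| ≥ |Y| − 1`
      obtain ⟨a, ha, b, hb, hab⟩ := Finset.one_lt_card.1 (show 1 < (R ∩ (insert z B \ coloops M G)).card by omega)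
      have hsub := hline a b (hQmem a (Finset.mem_inter.1 ha).2) (hQmem b (Finset.mem_inter.1 hb).2) hab
        (Finset.mem_inter.1 ha).1 (Finset.mem_inter.1 hb).1
      have hc : R ∩ Y ⊆ Y ∩ clF M {a, b} := fun r hr =>
        Finset.mem_inter.2 ⟨(Finset.mem_inter.1 hr).2, hsub (Finset.mem_inter.1 hr).1⟩
      have hc' := Finset.card_le_card hc
      have hb' := h2 a (Finset.mem_inter.1 ha).2 b (Finset.mem_inter.1 hb).2 hab
      omega


end PercRepro.Shadow
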